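import Summits.BirchSwinnertonDyer.BirchSwinnertonDyer.Theorems.AlignedTransportAtTwoMainConjectureOfRankZeroBSDAtTwoLayerValueDoublyDark
import HarnessLib

/-!
# Route `AlignedTransportAtTwo`, crux C2 `MainConjectureOfRankZeroBSDAtTwo` (stmt-BirchSwinnertonDyer-22298):
# ON THE CLEAN WEIGHT-2 CELL THE TWIN VALUE DECIDES `(μ, λ) = (0, 2)` EXACTLY — `ι`-stable `F` with `ord₂ F(0) = 2`:
# `μ(F) = 0 ∧ λ(F) = 2 ⟺ 3 ≤ ord₂ F(−2)`; so «LIT by the twin door» = `(μ, λ) = (0, 2)` and «doubly dark» = `μ ≥ 1 ∨ λ ≥ 4`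

HONEST FRAMING (cell `bsd-f1-sign2`, WIDTH-5 attached prover seat `bsd-line-att-p5` gen 50 on line `birth` of the lead
`bsd-line-att-p2`; `--supports` stmt-BirchSwinnertonDyer-22298, closes nothing; BSD is NOT proved by any of this; the crux C2, its
verdict «blocked-on `Rank1Residual.GreenbergMuConjectureIrreducible`» and every registered stub are untouched). THEOREMS ONLY — no `def`, no
instance, no named fact, no `sorry`. Combines g49's twin door (`…TwinValueLambda.lam_eq_two_of_twinValue`: twin value `≠ 2 = ord₂F(0) ⟹ μ = 0 ∧
λ = 2`, via PRINT `h114` at the datum level) with this gen's exclusion (`…LayerValueDoublyDark.eight_dvd_evalAt_neg_two_of_lam_eq_two`: `μ = 0`,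
`λ = 2`, `ord₂F(0) = 2 ⟹ 8 ∣ F(−2)`) into an EQUIVALENCE:
* ★★★ `mu_eq_zero_and_lam_eq_two_iff_three_le_twin` (Λ-level, `p = 2`): **`μ(F) = 0 ∧ λ(F) = 2 ⟺ 3 ≤ ord₂ F(−2)`**;
* ★★★ `mu_eq_zero_and_lambda_eq_two_iff_three_le_twin` (C2 datum, Euler weight `2`, PRINT `h114`): **`μ(X) = 0 ∧ λ(X) = 2 ⟺ 3 ≤ ord₂ f_X(−2)`**.
So the weight-2 clean cell splits EXACTLY: twin value `≥ 3` ⟺ `X(W/ℚ_∞) ≅` (up to finite) `ℤ₂²` with `μ = 0`; twin value `2` ⟺ `μ ≥ 1 ∨ λ ≥ 4`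
(the residue; memo `Cruxes/MainConjectureOfRankZeroBSDAtTwo/LAYER-VALUE-att-p5-g50.md`). BSD is not proved by any of this.

References: R. Greenberg, LNM 1716 (1999), Thm. 1.14, Thm. 4.1, §5 p. 181 [GreenbergLNM1716]; L. Washington, GTM 83, §7.1 [Washington1997];
B. Mazur, J. Tate, J. Teitelbaum, Invent. Math. 84 (1986) Ch. I §17 [MazurTateTeitelbaum1986Invent].
-/

set_option linter.dupNamespace false
set_option autoImplicit false

noncomputable section

open scoped Classical MatrixGroups ModularForm

namespace Summit.BirchSwinnertonDyer.BirchSwinnertonDyer.Theorems.AlignedTransportAtTwoLayerValueTwinExact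

open PowerSeries CongruenceSubgroup WeierstrassCurve Literature.NumberTheory.EllipticCurves
  Literature.NumberTheory.EllipticCurves.IwasawaAlgebra
  Literature.NumberTheory.EllipticCurves.ModularForms
  Literature.NumberTheory.EllipticCurves.Rank1Residual
  Literature.NumberTheory.EllipticCurves.Rank1Residual.Typed
  Literature.NumberTheory.EllipticCurves.Greenberg1999
  Summit.BirchSwinnertonDyer.Rank1Residual
  Summit.BirchSwinnertonDyer.Rank1Residual.X1.MuLambda
  Summit.BirchSwinnertonDyer.Rank1Residual.X1.MuPart
  Summit.BirchSwinnertonDyer.Rank1Residual.X1.ParitySqueeze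
  Summit.BirchSwinnertonDyer.Rank1Residual.X5
  Summit.BirchSwinnertonDyer.Rank1Residual.F1Sign2
  Summit.BirchSwinnertonDyer.Rank1Residual.Iwasawa
  Summit.BirchSwinnertonDyer.Rank1Residual.Supersingular
  Summit.BirchSwinnertonDyer.Rank1Residual.Supersingular.BlindLever
  Summit.BirchSwinnertonDyer.BirchSwinnertonDyer.Theorems
  Summit.BirchSwinnertonDyer.BirchSwinnertonDyer.Theorems.Rank1ResidualX1Defs
  Summit.BirchSwinnertonDyer.BirchSwinnertonDyer.Theorems.AlignedTransportAtTwoSeed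
  Summit.BirchSwinnertonDyer.BirchSwinnertonDyer.Theorems.AlignedTransportAtTwoCyclotomicLayerWeightEuler
  Summit.BirchSwinnertonDyer.BirchSwinnertonDyer.Theorems.AlignedTransportAtTwoTwistSaturation
  Summit.BirchSwinnertonDyer.BirchSwinnertonDyer.Theorems.AlignedTransportAtTwoTwinValueAlgebra
  Summit.BirchSwinnertonDyer.BirchSwinnertonDyer.Theorems.AlignedTransportAtTwoTwinValue
  Summit.BirchSwinnertonDyer.BirchSwinnertonDyer.Theorems.AlignedTransportAtTwoTwinValueParity
  Summit.BirchSwinnertonDyer.BirchSwinnertonDyer.Theorems.AlignedTransportAtTwoTwinValueLambda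
  Summit.BirchSwinnertonDyer.BirchSwinnertonDyer.Theorems.TwoAdicEulerCharKernel
  Summit.BirchSwinnertonDyer.BirchSwinnertonDyer.Theorems.AlignedTransportAtTwoLayerValueDoublyDark

/-! ## §1 The equivalence -/

section Iff

/-- ★★★ **`(μ, λ) = (0, 2)` ⟺ twin value `≥ 3`, at the Λ-level.** `F ∈ ℤ₂⟦T⟧`, `F ≠ 0`, `ι`-stable, `F(0) ≠ 0 ≠ F(−2)`, `ord₂ F(0) = 2`: then
**`μ(F) = 0 ∧ λ(F) = 2 ⟺ 3 ≤ ord₂ F(−2)`** (⟸: g49's `lam_eq_two_of_twinValue`; ⟹: `eight_dvd_evalAt_neg_two_of_lam_eq_two`). So the twin value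
`2` («doubly dark») is EXACTLY the locus `μ ≥ 1 ∨ λ ≥ 4` of the weight-`2` cell. [cite: GreenbergLNM1716, Thm. 1.14 (p. 68), §5 p. 181]
[cite: Washington1997, §7.1 (Weierstrass preparation, uniqueness)] -/
theorem mu_eq_zero_and_lam_eq_two_iff_three_le_twin {F : IwasawaAlgebra 2} (hF : F ≠ 0)
    (hι : ∃ u : (IwasawaAlgebra 2)ˣ, invol 2 F = u * F) (hc0 : PowerSeries.constantCoeff F ≠ 0)
    (h2 : evalAt (-2 : ℤ_[2]) F ≠ 0) (ha : (PowerSeries.constantCoeff F).valuation = 2) :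
    (mu F = 0 ∧ lam F = 2) ↔ 3 ≤ (evalAt (-2 : ℤ_[2]) F).valuation := by
  constructor
  · rintro ⟨hμ, hlam⟩
    have h4 : (2 : ℤ_[2]) ^ 2 ∣ PowerSeries.constantCoeff F := (two_pow_dvd_iff_le_valuation hc0 2).mpr (by omega)
    have h8 : ¬ (2 : ℤ_[2]) ^ 3 ∣ PowerSeries.constantCoeff F := fun h ↦ by
      have := (two_pow_dvd_iff_le_valuation hc0 3).mp h
      omega
    exact (two_pow_dvd_iff_le_valuation h2 3).mp (eight_dvd_evalAt_neg_two_of_lam_eq_two hF hμ hlam hι h4 h8)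
  · intro hb
    exact lam_eq_two_of_twinValue hF hι hc0 h2 (Or.inl ha) (by omega)

end Iff

section IffDatum

variable (κ : ZpExtension ℚ 2) (hκ : κ.IsCyclotomic) {γ : Field.absoluteGaloisGroup ℚ} (hγ : κ.IsTopGenerator γ)
  (hγ' : IsCyclotomicVariable 2 γ) (W : WeierstrassCurve ℚ) [W.IsElliptic] [W.IsGloballyMinimal]

include hκ hγ hγ' in
/-- ★★★ **ON THE CLEAN WEIGHT-2 CELL THE TWIN VALUE DECIDES `(μ(X), λ(X)) = (0, 2)` EXACTLY.** `W/ℚ` globally minimal, good ordinary at `2`,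
`Sel_{2^∞}(W/ℚ)` finite, normalised datum `(κ, γ)`, dual datum `D`, generator `f_X` with `f_X(−2) ≠ 0`, Euler weight `w = 2`; PRINT `h114`. Then
**`μ(X(W/ℚ_∞)) = 0 ∧ λ(X(W/ℚ_∞)) = 2 ⟺ 3 ≤ ord₂ f_X(−2)`**: LIT (g49's twin door) ⟺ `(0, 2)`; DOUBLY DARK ⟺ `μ ≥ 1 ∨ λ ≥ 4`.
[cite: GreenbergLNM1716, Thm. 1.14 (p. 68), Thm. 4.1 (p. 102)] [cite: MazurTateTeitelbaum1986Invent, Ch. I §17] -/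
theorem mu_eq_zero_and_lambda_eq_two_iff_three_le_twin (h114 : Greenberg1999_thm114_charIdeal_iota_invariant) (hord : IsOrdinaryAt W 2)
    (D : W.SelmerDualData κ γ) (hfin : Finite (W.selmerGroupPInfty 2)) {t e s : ℕ}
    (ht : Nat.card (AddCommGroup.primaryComponent W.toAffine.Point 2) = 2 ^ t)
    (he : Nat.card (AddCommGroup.primaryComponent ((integralModelInt W).map (Int.castRingHom (ZMod 2))).toAffine.Point 2) = 2 ^ e)
    (hs : Nat.card (W.selmerGroupPInfty 2) = 2 ^ s) (hw : padicValNat 2 W.tamagawaProduct + 2 * e + s - 2 * t = 2)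
    {fX : IwasawaAlgebra 2} (hchar : D.charIdeal = Ideal.span {fX}) (h2 : evalAt (-2 : ℤ_[2]) fX ≠ 0) :
    (D.mu = 0 ∧ D.lambda = 2) ↔ 3 ≤ (evalAt (-2 : ℤ_[2]) fX).valuation := by
  haveI : Module.Finite (IwasawaAlgebra 2) D.X := D.module_finite_holds hγ
  have hD : D.IsTorsion := isTorsion_of_finite κ hκ hγ W hord D hfin
  obtain ⟨-, hnorm⟩ := norm_constantCoeff_charGen_eq_of_thm41 W thm41_charValue_rankZero_anyPrime_holds
    ((isOrdinaryAt_iff W 2).mp hord).1 ((isOrdinaryAt_iff W 2).mp hord).2 hκ hγ hγ' D hD hchar hfin ht he hs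
  obtain ⟨hc0, hval⟩ := valuation_eq_of_norm_eq_two_inv_pow hnorm
  rw [hw] at hval
  have hfXne : fX ≠ 0 := fun h0 ↦ hc0 (by rw [h0, map_zero])
  have hι := iotaStable_charGen_of_thm114 h114 W hord hκ hγ D hD hchar
  have hmufX : mu fX = D.mu := mu_generator_eq_muInvariant D.X hD hfXne hchar
  have hlamfX : lam fX = D.lambda := lam_generator_eq_lambdaInvariant D.X hD hfXne hchar
  rw [← hmufX, ← hlamfX]
  exact mu_eq_zero_and_lam_eq_two_iff_three_le_twin hfXne hι hc0 h2 hval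

end IffDatum

end Summit.BirchSwinnertonDyer.BirchSwinnertonDyer.Theorems.AlignedTransportAtTwoLayerValueTwinExact

end
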